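import Literature.MathematicalPhysics.QuantumFieldTheory.Balaban1983to89.B9B8KnitLetterE12Sup

/-!
# `Balaban1983to89.B9B8KnitLetterE12FromM55` — THE JUNCTION COMPOSED WITH MODULE M5.5: Theorem 3.7's cube data AT def-Y's LETTER OF RECORD `parSymY`
# ⇒ the (3.42)₁ majorant of `η²G′(U; parKnitY)` AT PRINT's TRANSPORTERS ⇒ the consumer's (E12) sup line there — with NO displayed majorant left
# (junction J-B file 15: `B9Thm37GpTorusRegular.hasMajorant_conj_Gp_of_cubes` ∘ file 9 ∘ file 11, an end-to-end shape check of the chain)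

statement-level skeleton of published theorems with citation tags; proofs where landed; nothing here is a claim about the
Yang–Mills mass gap

T. Bałaban, *Propagators for lattice gauge theories in a background field*, Commun. Math. Phys. **99** (1985) 389–434 [`Balaban1985BackgroundPropagators`,
"[B9]"]; T. Bałaban, *Propagators and renormalization transformations for lattice gauge theories. II*, Commun. Math. Phys. **96** (1984) 223–250
[`Balaban1984PropagatorsII`, "[4]"]; T. Bałaban, *Spaces of regular gauge field configurations on a lattice and gauge fixing conditions*, Commun. Math.
Phys. **99** (1985) 75–102 [`Balaban1985RegularSpaces`, "[B8]"].

THE PRINT.  [B9] Thm 3.1 (3.42)₁ p. 397 `|G′(U; x, y)| ≤ B₀(Lʲη)²e^{−δ₀d}`-type bound, proved (p. 410) from Thm 3.7's random-walk expansion (3.87)–(3.90) over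
the cubes `□ ∈ 𝒟` («follows simply from Corollary 3.6 holding for all G′_□, □ ∈ 𝒟, from the bound (3.89) and Lemma 2.1» of [4]); p. 410 «a decay rate
arbitrarily close»; [B8] (1.101) p. 93: `|G′f|, |∇G′f|₍₁₎ ≦ B_G|f|₍₋₂₎` — the consumer's (E12).

WHY THIS FILE ∕ THE ARGUMENT.  Sub-row G-B9-LETTERS' module M5.5 (`B9Thm37GpTorusRegular.hasMajorant_conj_Gp_of_cubes`, p21) turns Theorem 3.7's cube data —
cube terms `T_□`, remainders `R_□` with (3.88) `Δ′_a·ΣT_□ = 1 − ΣR_□`, Cor. 3.6 block majorants of `conj b(η²T_□)`, (3.89) majorants of `conj b R_□`, overlap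
counts, [4] Lemma 2.1 at exponent `α₁` — into the majorant `N B₀c₁(1 − N′θc₁)⁻¹·ℓ(y)²e^{−(1−α₁)δ₀d}` of `conj b(η²G′)` for ANY letter `G′` with `G′Δ′_a = 1`.
At def-Y's letter of record `Δ′_a = Δ′_a(U; parSymY)` is invertible for `G`-valued `U` (`isUnit_deltaPrimeAY_parSymY`), so M5.5 applies to `G′(U; parSymY)`;
junction file 9 (`hasMajorant_conj_GpY_parKnitY_of_parSymY_len`) transports the majorant to print's transporters `parKnitY` by the resolvent expansion in the
block-diagonal difference `E = Δ′_sym − Δ′_knit` (`‖E‖ ≤ 32(d+1)²α₀′L^{−2k}`, a second application of [4] Lemma 2.1 at exponent `α₂`), and junction file 11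
(`norm_GpKnitY_apply_le`) reads the consumer's sup line off the majorant by a row sum.  This file composes the three, so that the ONLY analytic inputs left
are M5.5's own (cube data at `parSymY`, two instances of Lemma 2.1, two located smallness conditions, a row-sum constant).

CITATION HEADER (lean-in-tree rule).  Cell `lit-balaban`, sub-row G-B9-LETTERS, junction J-B file 15 → seat `lit-balaban-p33` gen 94.  REUSED BY NAME:
`B9Thm37GpTorusRegular.hasMajorant_conj_Gp_of_cubes` (M5.5, p21), `B9Thm311DeltaPrimePos.isUnit_deltaPrimeAY_parSymY` (dag-n06-j), `Node00.GpY_mul_deltaPrimeAY`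
(def-Y), `B6RandomWalk.{HasMajorant, c1_nonneg}` (b6arith), junction files 9 (`B9B8KnitLetterMajorantTransfer.hasMajorant_conj_GpY_parKnitY_of_parSymY_len`)
and 11 (`B9B8KnitLetterE12Sup.norm_GpKnitY_apply_le`).

WHAT THIS FILE PROVES (sorry-free; no definitions; nothing of [B9]'s analysis asserted).
* `restrict_GpY_mul_deltaPrimeAY_parSymY` (`G′Δ′_a = 1` over `ℝ` at the letter of record), `inv_factor_nonneg` (arithmetic);
* ★★★ **`hasMajorant_conj_GpY_parKnitY_of_cubes`** — M5.5's cube data at `parSymY` ⇒ `conj b(η²G′(U; parKnitY))` has the majorant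
  `A₁c₁(α₂)(1 − θ₂c₁(α₂))⁻¹·ℓ(y)²·e^{−(1−α₂)(1−α₁)δ₀d(y,y′)}`, `A₁ = N B₀c₁(α₁)(1 − N′θc₁(α₁))⁻¹`, `θ₂ = 32(d+1)²α₀′(M₂Σ‖b_j‖)A₁` (`η = etaS i = L^{−k}`, `c_f = L^k`);
* ★★★ **`norm_GpKnitY_apply_le_of_cubes`** — the consumer's (E12) sup line AT THE KNIT LETTER from the same data plus a row-sum constant `c` for
  `e^{−(1−α₂)(1−α₁)δ₀d}`: on a constant-level-`n` member, `(Lⁿη)²‖Λ(w)‖ ≤ r ∀w ⇒ ‖(GpKnitY η U Λ)(z)‖ ≤ (Σ‖b_j‖)·A₁c₁(α₂)(1 − θ₂c₁(α₂))⁻¹·c·M₂·r`.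

HONEST SCOPE.  Pure composition (plumbing) of landed theorems; the cube data of Theorem 3.7 at `parSymY` (sub-rows M5.1c ∕ M5.5's located suppliers), the
two Lemma 2.1 instances and the smallness conditions remain displayed hypotheses exactly as in M5.5; nothing of (3.42) is asserted.  Count-neutral; nothing
continuum, nothing about OS axioms or the mass gap.  No `sorry`, no `axiom`, no `instance`, no `notation`.  NEW file; nothing landed is modified.  Net new
unproved facts: 0.  Seat `lit-balaban-p33` gen 94, 2026-08-28.
-/

noncomputable section

namespace Literature.MathematicalPhysics.QuantumFieldTheory.Balaban1983to89.B9B8KnitLetterE12FromM55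

open Node00 B6KLevelCensusIndexV1 B6Geom246MultiLevelBox B9BackgroundsKLevelV1 B9Thm311DeltaPrimePos
open B6RandomWalk (HasMajorant Triangle254 Ineq261 Ineq263 c1_nonneg)
open B9Thm34Ext (toB6)
open B9GeoNormsKLevelV1 (geo9K)
open B9Eq352DivFormLetters (conj)
open B9Ineq349SiteComposite (etaS_pos)
open B6Ineq2142KLevelV1 (β)
open B7Prop2Explicit (AvgClosed pdev C0 c2')
open B9B8CarrierDictionary (liftCfg)
open B9B8AveragingJunction (parKnitY)
open B9Thm311PositivityKnitLetter (GpKnitY)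
open B9Thm37GpTorusRegular (hasMajorant_conj_Gp_of_cubes)
open B9B8KnitLetterMajorantTransfer (hasMajorant_conj_GpY_parKnitY_of_parSymY_len)
open B9B8KnitLetterE12Sup (norm_GpKnitY_apply_le)
open scoped Matrix Matrix.Norms.L2Operator

variable {d ℓ : ℕ} {hd : 1 ≤ d + 1} {hL : Odd (ℓ + 1) ∧ 1 < ℓ + 1} {b₀ b₁ : ℝ}
variable (i : KIdx d ℓ hd hL b₀ b₁) {N : ℕ} {G : Subgroup (Matrix (Fin N) (Fin N) ℂ)ˣ}
variable {ι : Type} [Fintype ι] [DecidableEq ι] (b : Module.Basis ι ℝ (Matrix (Fin N) (Fin N) ℂ))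
variable [Fintype (geo9K i).Site] [DecidableEq (geo9K i).Site] {Rr : ℝ} {Hp : Prop} (ιB : BlkY i → IBondY i)

omit [Fintype (geo9K i).Site] [DecidableEq (geo9K i).Site] in
/-- `G′(U; parSymY)·Δ′_a(U; parSymY) = 1` over `ℝ`, for a `G`-valued `U`, `G ≤ U(N)` (the `hinv` input of M5.5 at the letter of record).
[cite: Balaban1985BackgroundPropagators, (3.24)–(3.25) p.394 («G′ = (Δ′_a)⁻¹»), Thm 3.11 p.416] -/
theorem restrict_GpY_mul_deltaPrimeAY_parSymY (hG : G ≤ B7Prop2Explicit.unitaryUnits (Matrix (Fin N) (Fin N) ℂ))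
    {U : CfgY (Matrix (Fin N) (Fin N) ℂ) i} (hU : ∀ μ x, U μ x ∈ G) :
    (GpY i (parSymY i) U).restrictScalars ℝ * (deltaPrimeAY i (parSymY i) U).restrictScalars ℝ = 1 :=
  LinearMap.ext fun Λ => LinearMap.congr_fun (GpY_mul_deltaPrimeAY i (parSymY i) U (isUnit_deltaPrimeAY_parSymY i hG hU)) Λ

/-- arithmetic: `N′θc₁ < 1 ⇒ 0 ≤ (1 − N′θc₁)⁻¹`. [cite: Balaban1984PropagatorsII, (2.66) p.234, bookkeeping] -/
theorem inv_factor_nonneg {x : ℝ} (h : x < 1) : 0 ≤ (1 - x)⁻¹ := inv_nonneg.2 (by linarith)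

/-- ★★★ **M5.5's CUBE DATA AT THE LETTER OF RECORD ⇒ THE (3.42)₁ MAJORANT OF `η²G′(U; parKnitY)` AT PRINT's TRANSPORTERS.**  Hypotheses: `G ≤ U(N)`
averaging-closed, `N ≥ 1`, a `G`-valued `U` on [B7]'s class (52) at rate `α₀′` (`C₀α₀′ ≤ ⅓`, `2α₀′ ≤ c₂′`), print's units (`c_f = L^k`, `η = etaS i = L^{−k}`),
a real basis `b` with coordinate bound `M₂`; THEOREM 3.7's DATA AT `parSymY` exactly as in `B9Thm37GpTorusRegular.hasMajorant_conj_Gp_of_cubes` (cube terms `T_□`,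
remainders `R_□`, (3.88) against `Δ′_a(U; parSymY)`, Cor. 3.6 block majorants, (3.89) majorants, overlap counts `N, N′`, Lemma 2.1 at `(δ₀, α₁)`, `N′θc₁(α₁) < 1`);
and for the transfer a second Lemma 2.1 at `((1−α₁)δ₀, α₂)` with `θ₂c₁(α₂) < 1`, `θ₂ = 32(d+1)²α₀′(M₂Σ‖b_j‖)·A₁`, `A₁ = N B₀c₁(α₁)(1 − N′θc₁(α₁))⁻¹`.  Conclusion:
`conj b(η²G′(U; parKnitY))` has the majorant `A₁c₁(α₂)(1 − θ₂c₁(α₂))⁻¹·ℓ(y)²·e^{−(1−α₂)(1−α₁)δ₀d(y,y′)}`.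
[cite: Balaban1985BackgroundPropagators, Thm 3.1 (3.42) p.397, Thm 3.7 (3.87)–(3.90) pp.409–410, (3.19) p.393; Balaban1984PropagatorsII, Lemma 2.1 (2.61) p.234, (2.66)–(2.67) p.234] -/
theorem hasMajorant_conj_GpY_parKnitY_of_cubes [Nonempty (Fin N)] (hG : G ≤ B7Prop2Explicit.unitaryUnits (Matrix (Fin N) (Fin N) ℂ))
    (hGa : AvgClosed (d + 1) (ℓ + 1) G) {U : CfgY (Matrix (Fin N) (Fin N) ℂ) i} (hU : ∀ μ x, U μ x ∈ G)
    {α₀' : ℝ} (hα : 0 < α₀') (hα3 : C0 (d + 1) * α₀' ≤ 1 / 3) (hα2 : 2 * α₀' ≤ c2' (d + 1) (ℓ + 1))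
    (h52 : pdev (liftCfg U) < α₀' * ((((ℓ + 1 : ℕ) : ℝ) ^ i.k)⁻¹) ^ 2) (hcf : i.cf = (((ℓ + 1 : ℕ) : ℝ)) ^ i.k)
    {M₂ : ℝ} (hM₂ : 0 ≤ M₂) (hrepr : ∀ (v : Matrix (Fin N) (Fin N) ℂ) (j : ι), |b.repr v j| ≤ M₂ * ‖v‖)
    (htri : Triangle254 (toB6 (geo9K i) Rr Hp)) (hrefl : ∀ y : (geo9K i).Site, (geo9K i).dist y y = 0)
    (hdnn : ∀ y y' : (geo9K i).Site, 0 ≤ (geo9K i).dist y y')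
    -- Theorem 3.7's data at the letter of record
    (d₁ : ℕ) {δ₀ α₁ θ B₀ Nn Nn' : ℝ} {κ : Type} [Fintype κ] (S S' : κ → Finset (geo9K i).Site)
    (T R : κ → Module.End ℝ (SiteY i → Matrix (Fin N) (Fin N) ℂ))
    (hB₀ : 0 ≤ B₀) (hθ : 0 ≤ θ) (hN : 0 ≤ Nn) (hN' : 0 ≤ Nn') (hαδ₁ : 0 ≤ (1 - α₁) * δ₀)
    (h261₁ : Ineq261 d₁ (toB6 (geo9K i) Rr Hp) δ₀ α₁) (h263₁ : Ineq263 d₁ (toB6 (geo9K i) Rr Hp) δ₀ α₁)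
    (hsmall₁ : Nn' * θ * B6.c1 d₁ δ₀ α₁ < 1)
    (hT : ∀ k, HasMajorant (g := toB6 (geo9K i) Rr Hp) (fun p : SiteY i × ι => ιB (blkOf i.D.toDomains p.1)) (conj b ((etaS i ^ 2) • T k))
      (fun a a' => if a ∈ S k then B₀ * (geo9K i).len a ^ 2 * Real.exp (-(δ₀ * (geo9K i).dist a a')) else 0))
    (hcnt : ∀ a : (geo9K i).Site, (∑ k, if a ∈ S k then (1 : ℝ) else 0) ≤ Nn)
    (h389 : ∀ k, HasMajorant (g := toB6 (geo9K i) Rr Hp) (fun p : SiteY i × ι => ιB (blkOf i.D.toDomains p.1)) (conj b (R k))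
      (fun a a' => if a ∈ S' k then θ * Real.exp (-(δ₀ * (geo9K i).dist a a')) else 0))
    (hcnt' : ∀ a : (geo9K i).Site, (∑ k, if a ∈ S' k then (1 : ℝ) else 0) ≤ Nn')
    (h388 : (deltaPrimeAY i (parSymY i) U).restrictScalars ℝ * (∑ k, T k) = 1 - ∑ k, R k)
    -- the transfer's second Lemma 2.1 and smallness
    (d₂ : ℕ) {α₂ : ℝ} (hαδ₂ : 0 ≤ (1 - α₂) * ((1 - α₁) * δ₀))
    (h261₂ : Ineq261 d₂ (toB6 (geo9K i) Rr Hp) ((1 - α₁) * δ₀) α₂) (h263₂ : Ineq263 d₂ (toB6 (geo9K i) Rr Hp) ((1 - α₁) * δ₀) α₂)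
    (hsmall₂ : (32 * ((d : ℝ) + 1) ^ 2 * α₀' * (M₂ * ∑ j, ‖b j‖) * (Nn * B₀ * B6.c1 d₁ δ₀ α₁ * (1 - Nn' * θ * B6.c1 d₁ δ₀ α₁)⁻¹))
      * B6.c1 d₂ ((1 - α₁) * δ₀) α₂ < 1) :
    HasMajorant (g := toB6 (geo9K i) Rr Hp) (fun p : SiteY i × ι => ιB (blkOf i.D.toDomains p.1))
      (conj b ((etaS i ^ 2) • (GpY i (parKnitY i) U).restrictScalars ℝ))
      (fun a a' => (Nn * B₀ * B6.c1 d₁ δ₀ α₁ * (1 - Nn' * θ * B6.c1 d₁ δ₀ α₁)⁻¹) * B6.c1 d₂ ((1 - α₁) * δ₀) α₂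
          * (1 - (32 * ((d : ℝ) + 1) ^ 2 * α₀' * (M₂ * ∑ j, ‖b j‖) * (Nn * B₀ * B6.c1 d₁ δ₀ α₁ * (1 - Nn' * θ * B6.c1 d₁ δ₀ α₁)⁻¹))
              * B6.c1 d₂ ((1 - α₁) * δ₀) α₂)⁻¹
          * (geo9K i).len a ^ 2 * Real.exp (-((1 - α₂) * ((1 - α₁) * δ₀) * (geo9K i).dist a a'))) := by
  -- M5.5 at the letter of record
  have hGs := hasMajorant_conj_Gp_of_cubes i b ιB d₁ S S' T R (etaS_pos i).ne' hB₀ hθ hN hN' hαδ₁ htri hrefl hdnn h261₁ h263₁ hsmall₁ hT hcnt h389 hcnt'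
    (restrict_GpY_mul_deltaPrimeAY_parSymY i hG hU) h388
  have hA : 0 ≤ Nn * B₀ * B6.c1 d₁ δ₀ α₁ * (1 - Nn' * θ * B6.c1 d₁ δ₀ α₁)⁻¹ :=
    mul_nonneg (mul_nonneg (mul_nonneg hN hB₀) (c1_nonneg _ _ _)) (inv_factor_nonneg hsmall₁)
  exact hasMajorant_conj_GpY_parKnitY_of_parSymY_len i b ιB hG hGa hU hα hα3 hα2 h52 hcf hM₂ hrepr d₂ hA hαδ₂ htri hrefl hdnn h261₂ h263₂ hsmall₂ hGs

/-- ★★★ **THE CONSUMER's (E12) SUP LINE AT THE KNIT LETTER FROM M5.5's CUBE DATA** ([B8] (1.101) `|G′f| ≦ B_G|f|₍₋₂₎`): under the hypotheses of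
`hasMajorant_conj_GpY_parKnitY_of_cubes`, a corner-free section `ιB`, a constant-level-`n` member, and a row-sum constant `c` for `e^{−(1−α₂)(1−α₁)δ₀d}`: for
`η ≠ 0` and every `Λ` with `(Lⁿη)²‖Λ(w)‖ ≤ r` (all `w`), `‖(GpKnitY η U Λ)(z)‖ ≤ (Σ‖b_j‖)·A₁c₁(α₂)(1 − θ₂c₁(α₂))⁻¹·c·M₂·r` at every `z`.
[cite: Balaban1985RegularSpaces, (1.101) p.93, (1.95) p.92; Balaban1985BackgroundPropagators, Thm 3.1 (3.42) p.397, Thm 3.7 pp.409–410; Balaban1984PropagatorsII, (2.61) p.234] -/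
theorem norm_GpKnitY_apply_le_of_cubes [Nonempty (Fin N)] (hG : G ≤ B7Prop2Explicit.unitaryUnits (Matrix (Fin N) (Fin N) ℂ))
    (hGa : AvgClosed (d + 1) (ℓ + 1) G) {U : CfgY (Matrix (Fin N) (Fin N) ℂ) i} (hU : ∀ μ x, U μ x ∈ G)
    {α₀' : ℝ} (hα : 0 < α₀') (hα3 : C0 (d + 1) * α₀' ≤ 1 / 3) (hα2 : 2 * α₀' ≤ c2' (d + 1) (ℓ + 1))
    (h52 : pdev (liftCfg U) < α₀' * ((((ℓ + 1 : ℕ) : ℝ) ^ i.k)⁻¹) ^ 2) (hcf : i.cf = (((ℓ + 1 : ℕ) : ℝ)) ^ i.k)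
    (hι : ∀ s, β i.hN i.D i.hk (ιB s) = s) {n : ℕ} (hlev : ∀ z : SiteY i, levY i z = n)
    {M₂ : ℝ} (hM₂ : 0 ≤ M₂) (hrepr : ∀ (v : Matrix (Fin N) (Fin N) ℂ) (j : ι), |b.repr v j| ≤ M₂ * ‖v‖)
    (htri : Triangle254 (toB6 (geo9K i) Rr Hp)) (hrefl : ∀ y : (geo9K i).Site, (geo9K i).dist y y = 0)
    (hdnn : ∀ y y' : (geo9K i).Site, 0 ≤ (geo9K i).dist y y')
    (d₁ : ℕ) {δ₀ α₁ θ B₀ Nn Nn' : ℝ} {κ : Type} [Fintype κ] (S S' : κ → Finset (geo9K i).Site)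
    (T R : κ → Module.End ℝ (SiteY i → Matrix (Fin N) (Fin N) ℂ))
    (hB₀ : 0 ≤ B₀) (hθ : 0 ≤ θ) (hN : 0 ≤ Nn) (hN' : 0 ≤ Nn') (hαδ₁ : 0 ≤ (1 - α₁) * δ₀)
    (h261₁ : Ineq261 d₁ (toB6 (geo9K i) Rr Hp) δ₀ α₁) (h263₁ : Ineq263 d₁ (toB6 (geo9K i) Rr Hp) δ₀ α₁)
    (hsmall₁ : Nn' * θ * B6.c1 d₁ δ₀ α₁ < 1)
    (hT : ∀ k, HasMajorant (g := toB6 (geo9K i) Rr Hp) (fun p : SiteY i × ι => ιB (blkOf i.D.toDomains p.1)) (conj b ((etaS i ^ 2) • T k))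
      (fun a a' => if a ∈ S k then B₀ * (geo9K i).len a ^ 2 * Real.exp (-(δ₀ * (geo9K i).dist a a')) else 0))
    (hcnt : ∀ a : (geo9K i).Site, (∑ k, if a ∈ S k then (1 : ℝ) else 0) ≤ Nn)
    (h389 : ∀ k, HasMajorant (g := toB6 (geo9K i) Rr Hp) (fun p : SiteY i × ι => ιB (blkOf i.D.toDomains p.1)) (conj b (R k))
      (fun a a' => if a ∈ S' k then θ * Real.exp (-(δ₀ * (geo9K i).dist a a')) else 0))
    (hcnt' : ∀ a : (geo9K i).Site, (∑ k, if a ∈ S' k then (1 : ℝ) else 0) ≤ Nn')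
    (h388 : (deltaPrimeAY i (parSymY i) U).restrictScalars ℝ * (∑ k, T k) = 1 - ∑ k, R k)
    (d₂ : ℕ) {α₂ : ℝ} (hαδ₂ : 0 ≤ (1 - α₂) * ((1 - α₁) * δ₀))
    (h261₂ : Ineq261 d₂ (toB6 (geo9K i) Rr Hp) ((1 - α₁) * δ₀) α₂) (h263₂ : Ineq263 d₂ (toB6 (geo9K i) Rr Hp) ((1 - α₁) * δ₀) α₂)
    (hsmall₂ : (32 * ((d : ℝ) + 1) ^ 2 * α₀' * (M₂ * ∑ j, ‖b j‖) * (Nn * B₀ * B6.c1 d₁ δ₀ α₁ * (1 - Nn' * θ * B6.c1 d₁ δ₀ α₁)⁻¹))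
      * B6.c1 d₂ ((1 - α₁) * δ₀) α₂ < 1)
    {c : ℝ} (hrow : ∀ a : (geo9K i).Site, ∑ a' : (geo9K i).Site, Real.exp (-((1 - α₂) * ((1 - α₁) * δ₀) * (geo9K i).dist a a')) ≤ c)
    {η : ℝ} (hη : η ≠ 0) (Λ : SiteY i → Matrix (Fin N) (Fin N) ℂ) {r : ℝ} (hΛ : ∀ w, ((((ℓ + 1 : ℕ) : ℝ)) ^ n * η) ^ 2 * ‖Λ w‖ ≤ r)
    (z : SiteY i) :
    ‖GpKnitY i η U Λ z‖ ≤ (∑ j, ‖b j‖)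
      * ((Nn * B₀ * B6.c1 d₁ δ₀ α₁ * (1 - Nn' * θ * B6.c1 d₁ δ₀ α₁)⁻¹) * B6.c1 d₂ ((1 - α₁) * δ₀) α₂
          * (1 - (32 * ((d : ℝ) + 1) ^ 2 * α₀' * (M₂ * ∑ j, ‖b j‖) * (Nn * B₀ * B6.c1 d₁ δ₀ α₁ * (1 - Nn' * θ * B6.c1 d₁ δ₀ α₁)⁻¹))
              * B6.c1 d₂ ((1 - α₁) * δ₀) α₂)⁻¹)
      * c * M₂ * r := by
  have hK := hasMajorant_conj_GpY_parKnitY_of_cubes i b ιB hG hGa hU hα hα3 hα2 h52 hcf hM₂ hrepr htri hrefl hdnn d₁ S S' T R hB₀ hθ hN hN' hαδ₁ h261₁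
    h263₁ hsmall₁ hT hcnt h389 hcnt' h388 d₂ hαδ₂ h261₂ h263₂ hsmall₂
  have hA : 0 ≤ Nn * B₀ * B6.c1 d₁ δ₀ α₁ * (1 - Nn' * θ * B6.c1 d₁ δ₀ α₁)⁻¹ :=
    mul_nonneg (mul_nonneg (mul_nonneg hN hB₀) (c1_nonneg _ _ _)) (inv_factor_nonneg hsmall₁)
  have hA' : 0 ≤ (Nn * B₀ * B6.c1 d₁ δ₀ α₁ * (1 - Nn' * θ * B6.c1 d₁ δ₀ α₁)⁻¹) * B6.c1 d₂ ((1 - α₁) * δ₀) α₂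
      * (1 - (32 * ((d : ℝ) + 1) ^ 2 * α₀' * (M₂ * ∑ j, ‖b j‖) * (Nn * B₀ * B6.c1 d₁ δ₀ α₁ * (1 - Nn' * θ * B6.c1 d₁ δ₀ α₁)⁻¹))
          * B6.c1 d₂ ((1 - α₁) * δ₀) α₂)⁻¹ :=
    mul_nonneg (mul_nonneg hA (c1_nonneg _ _ _)) (inv_factor_nonneg hsmall₂)
  exact norm_GpKnitY_apply_le i b ιB hι hlev hcf U hA' hK hrow hM₂ hrepr hη Λ hΛ z

end Literature.MathematicalPhysics.QuantumFieldTheory.Balaban1983to89.B9B8KnitLetterE12FromM55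

end
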